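import Summits.Ventures.HodgeRepro2.T5SU11HaarBK

/-!
# The right Haar measure of `B = A N`: `d_r b = e^{2t} ds dt` in the chart `a_t n_s`; `ν = ((k, b) ↦ k b)_* (μ_K ⊗ d_r b)` — the Haar measure of `SU(1,1) = K B` as `dk d_r b`

The Borel subgroup is not unimodular (`T5SU11BorelHaar`, `T5SU11BorelHaarMeasure`: `Δ_B(a_τ n_σ) = e^{2τ}`),
so beside the left Haar measure `borelHaar = (a_t n_s)_* (ds dt)` it has the RIGHT Haar measure
`borelHaarRight := borelHaar.inv` (`b ↦ b⁻¹` transported; right-invariant by Mathlib's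
`inv.instIsMulRightInvariant`). In the chart `ζ = s + i t ↦ a_t n_s`, inversion is
`(a_t n_s)⁻¹ = a_{-t} n_{-e^{2t} s}` (`hyp_mul_unip_inv`), i.e. the map `invChart = shear (-2) ∘ neg` of
`ℂ = ℝ²` (`borelCoord_invChart`), and the exponential shears of `T5SU11BorelHaarNA` give
`(shear (-c))_* (ds dt) = e^{c t} ds dt` (`map_shear_volume'`), hence
**`borelHaarRight = (a_t n_s)_* (e^{2t} ds dt)`** (`borelHaarRight_eq_map`): the right Haar measure
has density `e^{2t} = Δ_B` against the left one in the chart. With the Haar measure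
`ν = ((b, k) ↦ b k)_* (borelHaar ⊗ μ_K)` of `T5SU11HaarBK` and the inversion invariance of `ν`
(`SU(1,1)` is unimodular, `T5SU11Unimodular`): **`ν = ((k, b) ↦ k b)_* (μ_K ⊗ borelHaarRight)`**
(`nu_eq_map_mulKB`) — `dg = dk d_r b` for `g = k b`, the `K B`-side companion of `dg = db dk` —
with `∫_G f dν = ∫_K ∫_B f(k b) d_r b dk` for integrable `f` (`integral_nu_iterated_KB`) and the
hypothesis-free form through the measurable bijection `mulKB` (`integral_nu_mulKB`). Nothing is
claimed about (N).

Blind lane: Mathlib + the HodgeRepro2 prefix only; no sorry; axioms ⊆ {propext, Classical.choice,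
Quot.sound}.
-/

namespace Summit.Ventures.HodgeRepro2.T5SU11BorelHaarRight

open MeasureTheory MeasureTheory.Measure Metric Filter Topology Set Complex
open T5UnitaryBound T5PoincareDensity T5PoincareInvariance T5PoincareMeasure T5SU11Unimodular
  T5SU11Fibration T5SU11FibrationHaar T5SU11Cartan T5SU11OneParameter T5BergmanCoefficient
  T5SU11HyperbolicSubgroup T5SU11UnipotentSubgroup T5SU11BorelSubgroup T5SU11Iwasawa
  T5SU11IwasawaUnique T5SU11BorelTransitive T5SU11IwasawaHaar T5SU11BorelHaar
  T5SU11BorelHaarMeasure T5SU11IwasawaMeasure T5SU11BorelHaarNA T5SU11HaarBK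
open scoped ENNReal NNReal

/-! ### Inversion in the chart `a_t n_s`: `(a_t n_s)⁻¹ = a_{-t} n_{-e^{2t} s}` -/

/-- `(a_t n_s)⁻¹ = a_{-t} n_{-e^{2t} s}`. -/
theorem hyp_mul_unip_inv (t s : ℝ) :
    (hyp t * unip s)⁻¹ = hyp (-t) * unip (-(Real.exp (2 * t) * s)) := by
  rw [mul_inv_rev, ← hyp_neg, ← unip_neg, unip_mul_hyp]
  congr 2
  ring_nf

/-- Inversion in the chart: `ζ ↦ shear (-2) (-ζ)`, i.e. `(s, t) ↦ (-e^{2t} s, -t)`. -/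
noncomputable def invChart (ζ : ℂ) : ℂ := shear (-2) (-ζ)

/-- `invChart ζ = (-e^{2 Im ζ} Re ζ, -Im ζ)`. -/
lemma invChart_eq (ζ : ℂ) : invChart ζ = ⟨-(Real.exp (2 * ζ.im) * ζ.re), -ζ.im⟩ := by
  apply Complex.ext
  · simp only [invChart, shear_re, Complex.neg_im, Complex.neg_re]
    ring_nf
  · rfl

/-- **Inversion in the chart**: `(borelCoord ζ)⁻¹ = borelCoord (invChart ζ)`. -/
theorem borelCoord_inv (ζ : ℂ) : (borelCoord ζ)⁻¹ = borelCoord (invChart ζ) := by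
  unfold borelCoord
  rw [hyp_mul_unip_inv, invChart_eq]

/-- `invChart` is continuous. -/
lemma continuous_invChart : Continuous invChart := (continuous_shear _).comp continuous_neg

/-- `invChart` is measurable. -/
lemma measurable_invChart : Measurable invChart := continuous_invChart.measurable

/-! ### `(shear (-c))_* (ds dt) = e^{c t} ds dt` and `(invChart)_* (ds dt) = e^{2t} ds dt` -/

/-- **The inverse shear carries `ds dt` to `e^{c t} ds dt`**:
`(shear (-c))_* dζ = e^{c Im ζ} dζ` (the inverse statement of `map_shear_volume`). -/
theorem map_shear_volume' (c : ℝ) :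
    Measure.map (shear (-c)) (volume : Measure ℂ) =
      volume.withDensity fun ζ => ENNReal.ofReal (Real.exp (c * ζ.im)) := by
  conv_lhs => rw [← map_shear_volume c]
  rw [Measure.map_map (measurable_shear _) (measurable_shear _)]
  have h : shear (-c) ∘ shear c = id := funext (shear_neg_shear c)
  rw [h, Measure.map_id]

/-- **`(invChart)_* (ds dt) = e^{2t} ds dt`**. -/
theorem map_invChart_volume :
    Measure.map invChart (volume : Measure ℂ) =
      volume.withDensity fun ζ => ENNReal.ofReal (Real.exp (2 * ζ.im)) := by
  have h : invChart = shear (-2) ∘ Neg.neg := rfl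
  rw [h, ← Measure.map_map (measurable_shear _) measurable_neg, Measure.map_neg_eq_self,
    map_shear_volume']

/-! ### The right Haar measure of `B` -/

/-- **The right Haar measure of `B = A N`**: `borelHaar.inv`, i.e. `b ↦ b⁻¹` transported. -/
noncomputable def borelHaarRight : Measure borelSubgroup := borelHaar.inv

/-- `borelHaarRight` is right-invariant. -/
instance instIsMulRightInvariantBorelHaarRight : IsMulRightInvariant borelHaarRight :=
  inv.instIsMulRightInvariant

/-- `borelHaarRight` is finite on compacts. -/
instance instIsFiniteMeasureOnCompactsBorelHaarRight : IsFiniteMeasureOnCompacts borelHaarRight :=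
  Measure.IsFiniteMeasureOnCompacts.inv

/-- `borelHaarRight` is positive on opens. -/
instance instIsOpenPosMeasureBorelHaarRight : IsOpenPosMeasure borelHaarRight :=
  Measure.IsOpenPosMeasure.inv

/-- `borelHaarRight` is σ-finite. -/
instance instSigmaFiniteBorelHaarRight : SigmaFinite borelHaarRight := inv.instSigmaFinite _

/-- `(borelCoordB ζ)⁻¹ = borelCoordB (invChart ζ)` in `B`. -/
lemma borelCoordB_inv (ζ : ℂ) : (borelCoordB ζ)⁻¹ = borelCoordB (invChart ζ) :=
  Subtype.ext (borelCoord_inv ζ)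

/-- **`borelHaarRight = (a_t n_s)_* (e^{2t} ds dt)`**: in the chart `ζ = s + i t ↦ a_t n_s` the
right Haar measure of `B` is `e^{2t} ds dt` — the left Haar measure `ds dt` times the modular
function `Δ_B(a_t n_s) = e^{2t}`. -/
theorem borelHaarRight_eq_map :
    borelHaarRight =
      Measure.map borelCoordB (volume.withDensity fun ζ => ENNReal.ofReal (Real.exp (2 * ζ.im))) := by
  unfold borelHaarRight Measure.inv borelHaar
  rw [Measure.map_map measurable_inv measurable_borelCoordB]
  have h : (Inv.inv ∘ borelCoordB) = borelCoordB ∘ invChart := funext fun ζ => borelCoordB_inv ζ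
  rw [h, ← Measure.map_map measurable_borelCoordB measurable_invChart, map_invChart_volume]

/-- **`∫_B f d_r b = ∫_ℂ e^{2t} f(a_t n_s) ds dt`** for EVERY `f`. -/
theorem integral_borelHaarRight {E : Type*} [NormedAddCommGroup E] [NormedSpace ℝ E]
    (f : borelSubgroup → E) :
    ∫ b, f b ∂borelHaarRight = ∫ ζ, Real.exp (2 * ζ.im) • f (borelCoordB ζ) := by
  rw [borelHaarRight_eq_map, measurableEmbedding_borelCoordB.integral_map,
    integral_withDensity_eq_integral_toReal_smul (by fun_prop)
      (ae_of_all _ fun ζ => ENNReal.ofReal_lt_top)]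
  congr 1
  funext ζ
  rw [ENNReal.toReal_ofReal (Real.exp_pos _).le]

/-! ### `ν = ((k, b) ↦ k b)_* (μ_K ⊗ borelHaarRight)`: the Haar measure of `SU(1,1) = K B` -/

/-- The multiplication map `K × B → SU(1,1)`, `(k, b) ↦ rot k · b`. -/
noncomputable def mulKB (p : Circle × borelSubgroup) : SU11 := rot p.1 * p.2

/-- `mulKB (k, b) = rot k · b`. -/
lemma mulKB_apply (u : Circle) (b : borelSubgroup) : mulKB (u, b) = rot u * b := rfl

/-- `(b · rot k)⁻¹ = rot k⁻¹ · b⁻¹`: inversion intertwines `mulBK` and `mulKB`. -/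
lemma inv_comp_mulBK :
    Inv.inv ∘ mulBK = mulKB ∘ Prod.swap ∘ Prod.map (Inv.inv : borelSubgroup → borelSubgroup)
      (Inv.inv : Circle → Circle) := by
  funext p
  simp only [Function.comp_apply, mulBK, mulKB, Prod.swap, Prod.map, mul_inv_rev, map_inv,
    Subgroup.coe_inv]

/-- `mulKB` is continuous. -/
lemma continuous_mulKB : Continuous mulKB :=
  (continuous_rot.comp continuous_fst).mul (continuous_subtype_val.comp continuous_snd)

/-- `mulKB = inv ∘ mulBK ∘ (inv × inv) ∘ swap`. -/
lemma mulKB_eq :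
    mulKB = Inv.inv ∘ mulBK ∘ Prod.map (Inv.inv : borelSubgroup → borelSubgroup)
      (Inv.inv : Circle → Circle) ∘ Prod.swap := by
  funext p
  obtain ⟨u, b⟩ := p
  simp only [Function.comp_apply, mulBK, mulKB, Prod.swap, Prod.map, mul_inv_rev, map_inv,
    Subgroup.coe_inv, inv_inv]

section measure

variable [MeasurableSpace Circle] [BorelSpace Circle]

/-- `mulKB` is measurable. -/
lemma measurable_mulKB : Measurable mulKB := continuous_mulKB.measurable

/-- `mulKB` is a measurable embedding `K × B → SU(1,1)` (a composition of the measurable embedding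
`mulBK` with measurable equivalences). -/
lemma measurableEmbedding_mulKB : MeasurableEmbedding mulKB := by
  rw [mulKB_eq]
  exact (MeasurableEquiv.inv SU11).measurableEmbedding.comp (measurableEmbedding_mulBK.comp
    (((MeasurableEquiv.inv borelSubgroup).prodCongr (MeasurableEquiv.inv Circle)).measurableEmbedding.comp
      (MeasurableEquiv.prodComm).measurableEmbedding))

/-- **`mulKB` is a bijection `K × B → SU(1,1)`**: `SU(1,1) = K B` uniquely. -/
theorem mulKB_bijective : Function.Bijective mulKB := by
  rw [mulKB_eq]
  exact (MeasurableEquiv.inv SU11).bijective.comp (mulBK_bijective.comp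
    (((MeasurableEquiv.inv borelSubgroup).prodCongr (MeasurableEquiv.inv Circle)).bijective.comp
      MeasurableEquiv.prodComm.bijective))

variable (μC : Measure Circle) [IsHaarMeasure μC]

/-- **THE HAAR MEASURE OF `SU(1,1) = K B` IS `dk d_r b`**: `ν = (mulKB)_* (μ_K ⊗ borelHaarRight)`
with `borelHaarRight` the RIGHT Haar measure of the Borel subgroup. -/
theorem nu_eq_map_mulKB : nu μC = Measure.map mulKB (μC.prod borelHaarRight) := by
  haveI : IsInvInvariant (nu μC) := isInvInvariant (nu μC)
  have h1 : nu μC = Measure.map Inv.inv (nu μC) := (map_inv_eq_self (nu μC)).symm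
  have h2 := Measure.map_prod_map borelHaar μC (measurable_inv (G := borelSubgroup))
    (measurable_inv (G := Circle))
  rw [h1, nu_eq_map_mulBK, Measure.map_map measurable_inv measurable_mulBK, inv_comp_mulBK,
    ← Measure.map_map measurable_mulKB (measurable_swap.comp (measurable_inv.prodMap measurable_inv)),
    ← Measure.map_map measurable_swap (measurable_inv.prodMap measurable_inv), ← h2,
    Measure.prod_swap, map_inv_eq_self μC]
  rfl

/-- **`∫_G f dν = ∫_{K × B} f(k b) d(μ_K ⊗ d_r b)`** for EVERY `f`. -/
theorem integral_nu_mulKB {E : Type*} [NormedAddCommGroup E] [NormedSpace ℝ E] (f : SU11 → E) :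
    ∫ g, f g ∂(nu μC) = ∫ p, f (mulKB p) ∂(μC.prod borelHaarRight) := by
  rw [nu_eq_map_mulKB, measurableEmbedding_mulKB.integral_map]

/-- **`∫_G f dν = ∫_K ∫_B f(k b) d_r b dk`** for `ν`-integrable `f` (Fubini over `K × B`). -/
theorem integral_nu_iterated_KB {E : Type*} [NormedAddCommGroup E] [NormedSpace ℝ E]
    [CompleteSpace E] (f : SU11 → E) (hf : Integrable f (nu μC)) :
    ∫ g, f g ∂(nu μC) = ∫ u, ∫ b, f (rot u * b) ∂borelHaarRight ∂μC := by
  rw [integral_nu_mulKB]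
  have hf' : Integrable (f ∘ mulKB) (μC.prod borelHaarRight) := by
    rw [← measurableEmbedding_mulKB.integrable_map_iff, ← nu_eq_map_mulKB]
    exact hf
  exact integral_prod (fun p => f (mulKB p)) hf'

end measure

end Summit.Ventures.HodgeRepro2.T5SU11BorelHaarRight
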